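import Summits.ValiantsHypothesis.ValiantsHypothesis.Theorems.DivisionGapPerDivisionHardStubJssContraction
import Summits.ValiantsHypothesis.ValiantsHypothesis.Theorems.DivisionGapPerDivisionHardStubFaceDescent
import Summits.ValiantsHypothesis.ValiantsHypothesis.Theorems.DivisionGapPerDivisionHardStubBlockArsenal
import Summits.ValiantsHypothesis.ValiantsHypothesis.Theorems.DivisionGapPerDivisionHardStubGenericCut
import Summits.ValiantsHypothesis.ValiantsHypothesis.Theorems.DivisionGapPerDivisionHardStubEdgeExtraction
import Summits.ValiantsHypothesis.ValiantsHypothesis.Theorems.DivisionGapPerDivisionHardStubTwoSidedCount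

/-!
# Crux `DivisionGap.PerDivisionHard` (stmt-ValiantsHypothesis-5065), line `pair-descent-jss-endpoint` —
the UNION BOUND, unconditionally: `PerDivisionHard`'s inequality for every torus-homogeneous
cofactor whose fittable-edge-signature sum is small at some admissible block parameters

`PerDivisionHard` asks: for every `c`, for all large `n`, every nonzero `h ∈ ℝ≥0[x_ij]` has
`2^{(log₂ n + c)^c} < L(per_n · h) + L(h)`.  The skeleton of the line
(`Cruxes/PerDivisionHard/Lines/pair_descent_jss_endpoint.lean`, v5–v6) reduces the crux to ONE
open stub, `stub_edgeEntropy`: every cheap torus-homogeneous `h` admits block parameters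
`b ≥ (log₂ n + d)^d`, `k ≥ 1` at which the two-sided union-bound sum `edgeSum h (4k+2) b k N`
(`N = b + b²k`; `Theorems/DivisionGapDefs.lean`) over the (row set, column set) signatures of the
`(b,k)`-FITTABLE EDGE PAIRS of `Newt(h)` differing in `≥ 4k+2` rows is below `C(n, N)²`.

This file proves the composition `edgeSum small ↦ crux inequality` with the entropy conclusion
taken as a HYPOTHESIS on `h` — no cheapness assumption, no `sorry`:

* `exists_rigidPlacement_of_smallEdgeSum` (registered sub-goal; section form
  `rigidPlacement_of_smallEdgeSum`): if `edgeSum h (4k+2) b k N < C(n,N)²` (`h ≠ 0`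
  torus-homogeneous, `k ≥ 1`) then some placement `eR, eC` of `G(b,k) ⊕ M₀` is RIGID for `h`:
  every weight cutting out the placed face whose top fibre agrees off the face has a top fibre
  with a single `G`-part.  (Two-sided placement by counting, `stub_twoSidedCount` p109074, on a
  pair of `N`-sets avoiding the signature of every bad edge pair; a two-element fibre agreeing off
  `G` contains an edge pair, `stub_edgeExtraction` p108990, whose difference is a nonzero
  circulation inside the placed block, hence has `≥ 4k+2` rows, all block rows, and block
  columns only — `placedFlow_card_rows`, `placedFlow_row_notPadding` — excluded.)
* `perDivisionHard_of_smallEdgeSum`: hence `2^{(log₂ n+c)^c} < L(per_n · h) + L(h)` for every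
  such `h` with `b ≥ (log₂ n + d)^d`, `d = d(c)`, `n ≥ n₀(c)` (generic cut `stub_genericCut`
  p107596, face descent `stub_faceDescent` p87774, JSS contraction `stub_jssContraction` p86475,
  hardness of the placed face `stub_blockArsenal` p87932).

In particular the crux holds on every class of cofactors for which the Newton-edge entropy bound
(dossier `Lines/pair-descent-jss-endpoint-k2-dossier-v2.md` §6, Conjecture G) is verified.
-/

noncomputable section

-- `Summit.ValiantsHypothesis.ValiantsHypothesis.…` is the tree's mandated single-conjunct layout
-- (Sub = Summit), so the duplicated namespace component is intended.
set_option linter.dupNamespace false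

namespace Summit.ValiantsHypothesis.ValiantsHypothesis.Theorems.DivisionGapPerDivisionHard

open MvPolynomial Literature.Computability.AlgebraicComplexity
open Summit.ValiantsHypothesis.ValiantsHypothesis.Theorems.ZeroOneTransfer.Negative
  (topComponent support_topComponent_subset topComponent_ne_zero)
open scoped NNReal

/-- Neighbours of a padding column: its own padding row only (local copy of
`adj_paddingCol` of `…CutsOutDiag.lean`, which the farm snapshot has not built yet). [folklore] -/
private theorem adj_paddingCol_aux {b k m : ℕ} {u : Fin m} {r : BlockV b k m}
    (hr : blockAdj b k m r (Sum.inr (Sum.inr u)) = true) : r = Sum.inr (Sum.inr u) := by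
  rcases r with i | ⟨i, j, t⟩ | u'
  · simp [blockAdj] at hr
  · simp [blockAdj] at hr
  · simp only [blockAdj, decide_eq_true_eq] at hr
    rw [hr]

/-- **Rigid placement from a small edge-signature sum.**  If `h ≠ 0` is torus-homogeneous, `k ≥ 1`
and `edgeSum h (4k+2) b k N < C(n,N)²` (`N = b + b²k`), then for some placement `eR, eC` of
`G(b,k) ⊕ M₀` EVERY weight `w` cutting out the placed face `G` whose top fibre agrees off `G` has a
top fibre with a single `G`-part.  Proof: place the block rows and columns on a pair `(R, C)` of
`N`-sets containing the signature of no bad edge pair (`stub_twoSidedCount`); a two-element fibre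
agreeing off `G` would contain an edge pair (`stub_edgeExtraction`) whose difference is a nonzero
circulation inside `G`, hence fittable, with `≥ 4k+2` rows (`placedFlow_card_rows`), all of them
block rows and all its columns block columns (`placedFlow_row_notPadding`) —
excluded. -/
theorem rigidPlacement_of_smallEdgeSum {n : ℕ} (b k : ℕ)
    (h : MvPolynomial (Fin n × Fin n) ℝ≥0) (hh : h ≠ 0) (htor : IsTorusHomogeneous h)
    (hk : 0 < k)
    (hsum : edgeSum h (4 * k + 2) b k (b + b * (b * k)) <
      n.choose (b + b * (b * k)) * n.choose (b + b * (b * k))) :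
    ∃ eR eC : BlockV b k (n - (b + b * (b * k))) ≃ Fin n,
      ∀ w : Fin n × Fin n → ℕ, CutsOut w (placedBlock eR eC) →
        (∀ m₁ ∈ (topComponent w h).support, ∀ m₂ ∈ (topComponent w h).support,
          ∀ e ∉ placedBlock eR eC, m₁ e = m₂ e) →
        ∃ u : (Fin n × Fin n) →₀ ℕ, HasSingleGPart (placedBlock eR eC) w h u := by
  classical
  set N := b + b * (b * k) with hN
  -- two-sided placement by counting
  obtain ⟨R, C, hRcard, hCcard, hgood⟩ := stub_twoSidedCount n N _ (edgeSigs h (4 * k + 2) b k N)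
    (fun s => s.1) (fun s => s.2) hsum
  obtain ⟨eR, heR₁, heR₂⟩ := exists_blockEquiv R b k (n - N) hRcard (by rw [hRcard])
  obtain ⟨eC, heC₁, heC₂⟩ := exists_blockEquiv C b k (n - N) hCcard (by rw [hCcard])
  refine ⟨eR, eC, fun w _ hagree => ?_⟩
  set G := placedBlock eR eC with hG
  have hdeg : ∀ p₁ ∈ h.support, ∀ p₂ ∈ h.support, p₁.degree = p₂.degree := by
    intro p₁ hp₁ p₂ hp₂
    obtain ⟨r₀, c₀, hrc⟩ := htor
    exact degree_eq_of_rowDegrees_eq ((hrc p₁ hp₁).1.trans (hrc p₂ hp₂).1.symm)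
  -- the top fibre is a single monomial
  have hfib : ∀ m₁ ∈ (topComponent w h).support, ∀ m₂ ∈ (topComponent w h).support, m₁ = m₂ := by
    intro m₁ hm₁ m₂ hm₂
    by_contra hne
    -- an edge inside the fibre
    obtain ⟨w', p₁, p₂, hsub, hp₁, hp₂, hp, hseg⟩ :=
      stub_edgeExtraction n h w m₁ m₂ hdeg hm₁ hm₂ hne
    have hs₁ := support_topComponent_subset _ h (hsub hp₁)
    have hs₂ := support_topComponent_subset _ h (hsub hp₂)
    have hedge : IsEdgePair h p₁ p₂ := ⟨hp, w', hp₁, hp₂, hseg⟩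
    -- the difference `D = p₁ - p₂`: supported on `G`, vanishing margins, nonzero
    obtain ⟨r₀, c₀, hrc⟩ := htor
    obtain ⟨hrow, hcol⟩ := sum_diff_eq_zero ((hrc p₁ hs₁).1.trans (hrc p₂ hs₂).1.symm)
      ((hrc p₁ hs₁).2.trans (hrc p₂ hs₂).2.symm)
    have hoff := hagree p₁ (hsub hp₁) p₂ (hsub hp₂)
    have hDG : ∀ e, (fun e => (p₁ e : ℤ) - p₂ e) e ≠ 0 → e ∈ G := fun e he => by
      by_contra heG
      exact he (by simp only [hoff e heG, sub_self])
    have hDne : ∃ e, (fun e => (p₁ e : ℤ) - p₂ e) e ≠ 0 := by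
      by_contra hall
      push Not at hall
      exact hp (Finsupp.ext fun e => by exact_mod_cast sub_eq_zero.mp (hall e))
    have hrows := placedFlow_card_rows eR eC hk hDG hrow hcol hDne
    have hTD : diffRows p₁ p₂ =
        Finset.univ.filter fun r => ∃ c', (p₁ (r, c') : ℤ) - p₂ (r, c') ≠ 0 := by
      simp only [diffRows, ne_eq, sub_eq_zero, Nat.cast_inj]
    -- so `(p₁, p₂)` is a bad edge pair; its rows lie in `R` and its columns in `C`
    have hfit : Fittable b k (diffCells p₁ p₂) := by
      refine ⟨n - N, eR, eC, fun e he => hDG e ?_⟩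
      have he' : p₁ e ≠ p₂ e := (Finset.mem_filter.mp he).2
      simpa [sub_eq_zero] using he'
    have hmem : (p₁, p₂) ∈ edgePairs h (4 * k + 2) b k := by
      unfold edgePairs
      exact Finset.mem_filter.mpr
        ⟨Finset.mk_mem_product hs₁ hs₂, hedge, by rw [hTD]; exact hrows, hfit⟩
    have hRsub : diffRows p₁ p₂ ⊆ R := by
      intro r hr
      rw [hTD] at hr
      obtain ⟨c', hc'⟩ := (Finset.mem_filter.mp hr).2
      have hpad := placedFlow_row_notPadding eR eC hDG hrow hcol hc'
      obtain ⟨x, rfl⟩ := eR.surjective r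
      rcases x with i | p | u
      · exact heR₁ i
      · exact heR₂ p
      · exact absurd (eR.symm_apply_apply _) (hpad u)
    have hCsub : diffCols p₁ p₂ ⊆ C := by
      intro c' hc'
      obtain ⟨r, hr⟩ := (Finset.mem_filter.mp hc').2
      have hr' : (p₁ (r, c') : ℤ) - p₂ (r, c') ≠ 0 := by
        simpa [sub_eq_zero] using hr
      have hpad := placedFlow_row_notPadding eR eC hDG hrow hcol hr'
      have hcell : (r, c') ∈ G := hDG _ hr'
      have hadj : blockAdj b k (n - N) (eR.symm r) (eC.symm c') = true := by
        simpa [hG, placedBlock] using hcell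
      obtain ⟨y, rfl⟩ := eC.surjective c'
      rcases y with j | p | u
      · exact heC₁ j
      · exact heC₂ p
      · rw [Equiv.symm_apply_apply] at hadj
        exact absurd (adj_paddingCol_aux hadj) (hpad u)
    have hsig : (diffRows p₁ p₂, diffCols p₁ p₂) ∈ edgeSigs h (4 * k + 2) b k N := by
      unfold edgeSigs
      refine Finset.mem_filter.mpr ⟨Finset.mem_image.mpr ⟨(p₁, p₂), hmem, rfl⟩, ?_, ?_⟩
      · exact hRcard ▸ Finset.card_le_card hRsub
      · exact hCcard ▸ Finset.card_le_card hCsub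
    exact hgood _ hsig ⟨hRsub, hCsub⟩
  obtain ⟨m₀, hm₀⟩ := support_nonempty.mpr (topComponent_ne_zero w hh)
  refine ⟨m₀.filter (· ∈ G), fun e he => ?_, fun m' hm' e he => ?_⟩
  · rw [Finsupp.support_filter] at he
    exact (Finset.mem_filter.mp he).2
  · rw [hfib m' hm' m₀ hm₀, Finsupp.filter_apply_pos _ _ he]

/-- **Rigid placement from a small edge-signature sum** (registered sub-goal
`exists_rigidPlacement_of_smallEdgeSum` of crux stmt-ValiantsHypothesis-5065, explicit binders):
see `rigidPlacement_of_smallEdgeSum`. -/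
theorem exists_rigidPlacement_of_smallEdgeSum :
    ∀ (n b k : ℕ) (h : MvPolynomial (Fin n × Fin n) ℝ≥0), h ≠ 0 → IsTorusHomogeneous h → 0 < k →
      edgeSum h (4 * k + 2) b k (b + b * (b * k)) <
        n.choose (b + b * (b * k)) * n.choose (b + b * (b * k)) →
      ∃ eR eC : BlockV b k (n - (b + b * (b * k))) ≃ Fin n,
        ∀ w : Fin n × Fin n → ℕ, CutsOut w (placedBlock eR eC) →
          (∀ m₁ ∈ (topComponent w h).support, ∀ m₂ ∈ (topComponent w h).support,
            ∀ e ∉ placedBlock eR eC, m₁ e = m₂ e) →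
          ∃ u : (Fin n × Fin n) →₀ ℕ, HasSingleGPart (placedBlock eR eC) w h u :=
  fun _ b k h hh htor hk hsum => rigidPlacement_of_smallEdgeSum b k h hh htor hk hsum

/-- **The union bound, unconditionally: `PerDivisionHard`'s inequality for every nonzero
torus-homogeneous cofactor whose fittable-edge-signature sum is small at some admissible block
parameters** — no cheapness hypothesis; this is the composition `stub_edgeEntropy ↦ crux` of the
skeleton with the entropy conclusion taken as a hypothesis on `h` (rigid placement, generic cut,
face descent, JSS contraction, hardness of the placed face).  In particular the crux holds on every
class of cofactors for which the Newton-edge entropy bound is verified. -/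
theorem perDivisionHard_of_smallEdgeSum :
    ∀ c : ℕ, ∃ d n₀ : ℕ, ∀ n ≥ n₀, ∀ h : MvPolynomial (Fin n × Fin n) ℝ≥0,
      h ≠ 0 → IsTorusHomogeneous h →
      (∃ b k : ℕ, (Nat.log 2 n + d) ^ d ≤ b ∧ 0 < k ∧
        edgeSum h (4 * k + 2) b k (b + b * (b * k)) <
          n.choose (b + b * (b * k)) * n.choose (b + b * (b * k))) →
      2 ^ ((Nat.log 2 n + c) ^ c) < complexity (perPoly (Fin n) ℝ≥0 * h) + complexity h := by
  classical
  intro c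
  obtain ⟨κ, hcon⟩ := stub_jssContraction
  obtain ⟨d, n₁, hhard⟩ := stub_blockArsenal c κ
  refine ⟨d, n₁, fun n hn h hh htor ⟨b, k, hb, hk, hsum⟩ => ?_⟩
  obtain ⟨eR, eC, hrigid⟩ := rigidPlacement_of_smallEdgeSum b k h hh htor hk hsum
  set G := placedBlock eR eC with hG
  have hdeg : ∀ p₁ ∈ h.support, ∀ p₂ ∈ h.support, p₁.degree = p₂.degree := by
    intro p₁ hp₁ p₂ hp₂
    obtain ⟨r₀, c₀, hrc⟩ := htor
    exact degree_eq_of_rowDegrees_eq ((hrc p₁ hp₁).1.trans (hrc p₂ hp₂).1.symm)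
  obtain ⟨w, hcut, hagree⟩ := stub_genericCut b k _ n eR eC h hk hdeg
  obtain ⟨u, hsingle⟩ := hrigid w hcut hagree
  by_contra hlt
  have hle : complexity (perPoly (Fin n) ℝ≥0 * h) + complexity h ≤
      2 ^ ((Nat.log 2 n + c) ^ c) := not_lt.mp hlt
  have hdesc := stub_faceDescent n G w h u hcut hh hsingle
  have h2 : complexity (facePer G) ≤ ((n + 2) * (2 ^ ((Nat.log 2 n + c) ^ c) + 3)) ^ κ :=
    calc complexity (facePer G)
        ≤ ((n + 2) * (complexity (monomial u (1 : ℝ≥0) * facePer G) + 2)) ^ κ :=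
          hcon n (facePer G) u
      _ ≤ ((n + 2) * (2 ^ ((Nat.log 2 n + c) ^ c) + 3)) ^ κ := by
          refine Nat.pow_le_pow_left (Nat.mul_le_mul_left _ ?_) κ
          have := le_trans hdesc (Nat.add_le_add_right (le_trans (Nat.le_add_right _ _) hle) 1)
          omega
  have h3 := hhard n hn b k _ eR eC hb
  exact absurd (lt_of_lt_of_le h3 h2) (lt_irrefl _)

end Summit.ValiantsHypothesis.ValiantsHypothesis.Theorems.DivisionGapPerDivisionHard

end
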